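import Mathlib
import Summits.AtomisticToContinuum.Crystallization.Theorems.FrustratedLawDichotomyPeriodicSurgeryTest
import Literature.MathematicalPhysics.StatisticalMechanics.MuGroundStateConfiguration

/-!
# FrustratedLawDichotomy · cruxes `AperiodicFrustratedLawGap` / `PeriodicFrustratedLawGap` (stmt-AtomisticToContinuum-27623 / 27624) —
# AN EXACT PERIODIC MINIMISER IS AN `e⋆`-μ-GROUND-STATE CONFIGURATION (Sütő), UNCONDITIONALLY
# (decomp-a2c, prover hand 2, structural share, generation 5)

`isMuGSC_points_of_energyPerParticle_le`: if a `δ`-separated periodic configuration `Q` of `ℝ³` has `e(Q) ≤ e⋆` (i.e. is an EXACT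
Lennard-Jones minimiser among periodic configurations), then its point set is an `e⋆`-μGSC of `V_LJ`
(`Literature…MuGroundStateConfiguration.IsMuGSC`): no finite surgery «remove `n` atoms, insert `k` atoms» lowers `U − e⋆·#`.  This is the
PERIODIC CASE of the μ-equilibrium door `GrainCoreNetworkSplit.MuEquilibriumDoor` (item 27073, tree-proved for all point-stationary laws as
`EquilibriumInLaw.stub_equilibriumInLaw` but with an import chain that is not built on the farm), proved here from scratch and door-free:
`n ≥ 1` is `FrustratedLawDichotomyPeriodicSurgeryTest`, pure insertions `n = 0, k ≥ 1` are `eStar_lt_energyPerParticle_of_insertion_periodic`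
below (supercell with the `k` atoms added to the motif; far copies only attract), `n = k = 0` is trivial, and the convergence clause is the
summability of Lennard-Jones lattice sums (`PeriodicConfigurationSums`).  Consequently every k-atom census test of
`FrustratedLawDichotomyGSCSurgeryTests` / `…Certificates` is UNCONDITIONAL on periodic candidates.  All `[folklore]`.
-/

noncomputable section

namespace Summit.AtomisticToContinuum.Crystallization.Theorems.FrustratedLawDichotomyPeriodicMuGSC

open Literature.MathematicalPhysics.StatisticalMechanics
open Summit.AtomisticToContinuum.Crystallization.Theorems.ChargedEnergyGapNegative (E3 eStar eStar_le)
open Summit.AtomisticToContinuum.Crystallization.Theorems.FrustratedLawDichotomyPeriodicSubconfiguration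
open Summit.AtomisticToContinuum.Crystallization.Theorems.FrustratedLawDichotomyPeriodicSupercell (exists_supercell_points_energy tsum_site_eq_of_sub_mem_lattice)
open Summit.AtomisticToContinuum.Crystallization.Theorems.FrustratedLawDichotomyPeriodicRemovalTest (le_norm_of_mem_lattice)
open Summit.AtomisticToContinuum.Crystallization.Theorems.FrustratedLawDichotomyPeriodicSurgeryTest (eStar_lt_energyPerParticle_of_surgery_periodic)

/-- **UNCONDITIONAL INSERTION TEST** (`n = 0`, `k ≥ 1`): a `δ`-separated periodic `Q` and `k` distinct points `R` off `Q` with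
`U(R) + Σ_i I(R_i, Q) < e(Q)·k` give `e⋆ < e(Q)` (supercell with `R` added to the motif; the far lattice copies of `R` only attract). [folklore] -/
theorem eStar_lt_energyPerParticle_of_insertion_periodic (Q : PeriodicConfiguration 3)
    {δ : ℝ} (hδ : 0 < δ) (hsep : ∀ p ∈ Q.points, ∀ q ∈ Q.points, p ≠ q → δ ≤ dist p q)
    {k : ℕ} (hkpos : 0 < k) {R : Fin k → E3} (hR : Function.Injective R) (hRQ : ∀ i, R i ∉ Q.points)
    (hviol : interactionEnergy lennardJones R + ∑ i, ∑' y : ↥Q.points, lennardJones (dist (R i) y) <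
      Q.energyPerParticle lennardJones * k) :
    (⨅ Q' : PeriodicConfiguration 3, Q'.energyPerParticle lennardJones) < Q.energyPerParticle lennardJones := by
  classical
  by_contra hle
  rw [not_lt] at hle
  set e : ℝ := Q.energyPerParticle lennardJones with he_def
  have heq : e = ⨅ Q' : PeriodicConfiguration 3, Q'.energyPerParticle lennardJones := le_antisymm hle (eStar_le Q)
  set ρ : ℝ := ∑ i, ‖R i‖ with hρ_def
  have hρR : ∀ i, ‖R i‖ ≤ ρ := fun i =>
    Finset.single_le_sum (f := fun i => ‖R i‖) (fun _ _ => norm_nonneg _) (Finset.mem_univ i)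
  have hd2 : ∀ i j, ‖R i - R j‖ ≤ 2 * ρ := fun i j => (norm_sub_le _ _).trans (by linarith [hρR i, hρR j])
  obtain ⟨kk, hkk⟩ := exists_nat_gt ((2 * ρ + 2) / δ)
  set K : ℕ := kk + 1 with hK_def
  have hKk : (2 * ρ + 2) / δ < (K : ℝ) := hkk.trans (by rw [hK_def]; push_cast; linarith)
  have hKδ : 2 * ρ + 2 < (K : ℝ) * δ := by rwa [div_lt_iff₀ hδ] at hKk
  obtain ⟨P, hpts, hen, hlat⟩ := exists_supercell_points_energy Q K
  have heP : P.energyPerParticle lennardJones = e := by rw [he_def, hen]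
  have hlong : ∀ g ∈ P.lattice, g ≠ 0 → (K : ℝ) * δ ≤ ‖g‖ := by
    intro g hg hg0
    obtain ⟨g₀, hg₀, rfl⟩ := (hlat g).1 hg
    have hg₀0 : g₀ ≠ 0 := fun h => hg0 (by rw [h, smul_zero])
    rw [norm_smul, Real.norm_natCast]
    exact mul_le_mul_of_nonneg_left (le_norm_of_mem_lattice Q hsep hg₀ hg₀0) (Nat.cast_nonneg K)
  have hshort : ∀ g ∈ P.lattice, ‖g‖ < (K : ℝ) * δ → g = 0 := fun g hg hlt => by
    by_contra h; exact absurd (hlong g hg h) (not_le.2 hlt)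
  have hRP : ∀ i, R i ∉ P.points := fun i => by rw [hpts]; exact hRQ i
  -- the inserted sub-motif and the surgered configuration
  set Rset : Finset E3 := Finset.univ.image R with hRset
  have hRne : Rset.Nonempty := ⟨R ⟨0, hkpos⟩, Finset.mem_image_of_mem R (Finset.mem_univ _)⟩
  have hMR : Disjoint P.motif Rset := by
    rw [Finset.disjoint_left]
    intro a ha haR
    obtain ⟨i, -, rfl⟩ := Finset.mem_image.1 haR
    exact hRP i (P.mem_points_of_mem_motif ha)
  have hineq : ∀ x ∈ P.motif ∪ Rset, ∀ y ∈ P.motif ∪ Rset, x - y ∈ P.lattice → x = y := by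
    intro x hx y hy hxy
    rcases Finset.mem_union.1 hx with hxM | hxR <;> rcases Finset.mem_union.1 hy with hyM | hyR
    · exact P.eq_of_sub_mem x hxM y hyM hxy
    · obtain ⟨i, -, rfl⟩ := Finset.mem_image.1 hyR
      exfalso; apply hRP i
      exact ⟨x, hxM, -(x - R i), P.lattice.neg_mem hxy, by abel⟩
    · obtain ⟨i, -, rfl⟩ := Finset.mem_image.1 hxR
      exfalso; apply hRP i
      exact ⟨y, hyM, R i - y, hxy, by abel⟩
    · obtain ⟨i, -, rfl⟩ := Finset.mem_image.1 hxR
      obtain ⟨j, -, rfl⟩ := Finset.mem_image.1 hyR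
      have h3 : ‖R i - R j‖ < (K : ℝ) * δ := by linarith [hd2 i j]
      exact sub_eq_zero.1 (hshort _ hxy h3)
  let Rcf : PeriodicConfiguration 3 :=
    { lattice := P.lattice, discrete := P.discrete, isZLattice := P.isZLattice, motif := Rset, motif_nonempty := hRne,
      eq_of_sub_mem := fun x hx y hy h => hineq x (Finset.mem_union_right _ hx) y (Finset.mem_union_right _ hy) h }
  let Ap : PeriodicConfiguration 3 :=
    { lattice := P.lattice, discrete := P.discrete, isZLattice := P.isZLattice, motif := P.motif ∪ Rset,
      motif_nonempty := P.motif_nonempty.mono Finset.subset_union_left, eq_of_sub_mem := hineq }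
  have hunion : Ap.points = P.points ∪ Rcf.points :=
    points_eq_union (P := Ap) (A := P) (B := Rcf) rfl rfl Finset.subset_union_left Finset.subset_union_right
      (fun x hx => Finset.mem_union.1 hx)
  have hdisj : Disjoint P.points Rcf.points :=
    disjoint_points (P := Ap) (A := P) (B := Rcf) rfl rfl Finset.subset_union_left Finset.subset_union_right hMR
  have hRpts : ∀ z : E3, z ∈ Rcf.points ↔ ∃ j, ∃ g ∈ P.lattice, z = R j + g := by
    intro z; constructor
    · rintro ⟨b, hb, g, hg, rfl⟩
      obtain ⟨j, -, rfl⟩ := Finset.mem_image.1 hb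
      exact ⟨j, g, hg, rfl⟩
    · rintro ⟨j, g, hg, rfl⟩
      exact ⟨R j, Finset.mem_image_of_mem R (Finset.mem_univ j), g, hg, rfl⟩
  have hRR : ∀ i, R i ∈ Rcf.points := fun i => (hRpts _).2 ⟨i, 0, P.lattice.zero_mem, (add_zero _).symm⟩
  have haR : ∀ x ∈ P.motif, x ∉ Rcf.points := fun x hx h => Set.disjoint_left.1 hdisj (P.mem_points_of_mem_motif hx) h
  have hfarR : ∀ z ∈ Rcf.points, z ∉ Set.range R → ∀ i, 1 ≤ dist (R i) z := by
    intro z hz hzr i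
    obtain ⟨j, g, hg, rfl⟩ := (hRpts z).1 hz
    have hg0 : g ≠ 0 := fun h => hzr ⟨j, by rw [h, add_zero]⟩
    have h1 := hlong g hg hg0
    have h2 : ‖g‖ - ‖R i - R j‖ ≤ dist (R i) (R j + g) := by
      rw [dist_eq_norm, show R i - (R j + g) = (R i - R j) - g by abel, norm_sub_rev (R i - R j) g]
      exact norm_sub_norm_le _ _ |>.trans (le_of_eq (by rw [norm_sub_rev]))
    linarith [hd2 i j]
  -- site-type sums
  set siteP : E3 → ℝ := fun x => ∑' y : {y : E3 // y ∈ P.points ∧ y ≠ x}, lennardJones (dist x y.1) with hsiteP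
  set siteAp : E3 → ℝ := fun x => ∑' y : {y : E3 // y ∈ Ap.points ∧ y ≠ x}, lennardJones (dist x y.1) with hsiteAp
  set siteR : E3 → ℝ := fun x => ∑' y : {y : E3 // y ∈ Rcf.points ∧ y ≠ x}, lennardJones (dist x y.1) with hsiteR
  set H : Fin k → ℝ := fun i => ∑' z : ↥(Rcf.points \ Set.range R), lennardJones (dist (R i) z) with hH
  set IR : Fin k → ℝ := fun i => ∑' y : ↥Q.points, lennardJones (dist (R i) y) with hIR
  -- energies
  have hE1 : 2 * (P.motif.card : ℝ) * e = ∑ x ∈ P.motif, siteP x := by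
    rw [← heP]; exact twice_card_mul_energyPerParticle P lennardJones
  have hcardAp : (P.motif ∪ Rset).card = P.motif.card + k := by
    rw [Finset.card_union_of_disjoint hMR, hRset, Finset.card_image_of_injective _ hR, Finset.card_univ, Fintype.card_fin]
  have hE2 : 2 * ((P.motif.card : ℝ) + k) * Ap.energyPerParticle lennardJones = ∑ x ∈ P.motif, siteAp x + ∑ i, siteAp (R i) := by
    have h := twice_card_mul_energyPerParticle Ap lennardJones
    have hm : Ap.motif = P.motif ∪ Rset := rfl
    rw [hm, hcardAp, Nat.cast_add, Finset.sum_union hMR, hRset, Finset.sum_image (fun i _ j _ h => hR h)] at h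
    exact h
  have hE2' : 2 * ((P.motif.card : ℝ) + k) * e ≤ 2 * ((P.motif.card : ℝ) + k) * Ap.energyPerParticle lennardJones := by
    have h0 : (⨅ Q' : PeriodicConfiguration 3, Q'.energyPerParticle lennardJones) ≤ Ap.energyPerParticle lennardJones := eStar_le Ap
    have h1 : e ≤ Ap.energyPerParticle lennardJones := heq ▸ h0
    have h2 : (0 : ℝ) ≤ 2 * ((P.motif.card : ℝ) + k) := by
      have ha : (0 : ℝ) ≤ P.motif.card := Nat.cast_nonneg _
      have hb : (0 : ℝ) ≤ k := Nat.cast_nonneg _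
      linarith
    exact mul_le_mul_of_nonneg_left h1 h2
  have hE3 : ∑ x ∈ P.motif, siteAp x = ∑ x ∈ P.motif, siteP x + ∑ x ∈ P.motif, siteR x := by
    rw [← Finset.sum_add_distrib]
    exact Finset.sum_congr rfl fun x _ => tsum_site_split Ap hunion hdisj x
  have hE4 : ∀ x ∈ P.motif, siteR x = ∑ i, ∑' l : ↥P.lattice, lennardJones (dist (R i) (x + (l : E3))) := by
    intro x hx
    simp only [hsiteR]
    rw [tsum_points_eq_sum_tsum_lattice Rcf (haR x hx)]
    show ∑ b ∈ Rset, ∑' l : ↥P.lattice, lennardJones (dist x (b + (l : E3))) = _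
    rw [hRset, Finset.sum_image (fun i _ j _ h => hR h)]
    exact Finset.sum_congr rfl fun i _ => tsum_lattice_symm P.lattice lennardJones x (R i)
  have hE5 : ∀ i, ∑ x ∈ P.motif, ∑' l : ↥P.lattice, lennardJones (dist (R i) (x + (l : E3))) = IR i := by
    intro i
    rw [← tsum_points_eq_sum_tsum_lattice P (hRP i)]
    simp only [hIR]
    have hset : {y : E3 | y ∈ P.points ∧ y ≠ R i} = Q.points := by rw [setOf_points_ne_eq (hRP i), hpts]
    exact tsum_congr_set_coe (fun y : E3 => lennardJones (dist (R i) y)) hset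
  have hE45 : ∑ x ∈ P.motif, siteR x = ∑ i, IR i := by
    rw [Finset.sum_congr rfl hE4, Finset.sum_comm]
    exact Finset.sum_congr rfl fun i _ => hE5 i
  have hE6 : ∀ i, siteAp (R i) = IR i + siteR (R i) := by
    intro i
    have h := tsum_site_split Ap hunion hdisj (R i)
    have hset : {y : E3 | y ∈ P.points ∧ y ≠ R i} = Q.points := by rw [setOf_points_ne_eq (hRP i), hpts]
    have hc : (∑' y : {y : E3 // y ∈ P.points ∧ y ≠ R i}, lennardJones (dist (R i) y.1)) =
        ∑' y : ↥Q.points, lennardJones (dist (R i) (y : E3)) := by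
      have := tsum_congr_set_coe (fun y : E3 => lennardJones (dist (R i) y)) hset
      exact this
    rw [hc] at h
    exact h
  have hsetR : ∀ i, {z : E3 | z ∈ Rcf.points ∧ z ≠ R i} =
      (↑((Finset.univ.erase i).image R) : Set E3) ∪ (Rcf.points \ Set.range R) := by
    intro i
    ext z
    rw [Set.mem_setOf_eq, Set.mem_union, Finset.mem_coe, Finset.mem_image, Set.mem_sdiff, Set.mem_range]
    constructor
    · rintro ⟨hz, hzi⟩
      by_cases hr : ∃ j, R j = z
      · obtain ⟨j, rfl⟩ := hr
        exact Or.inl ⟨j, Finset.mem_erase.2 ⟨fun h => hzi (by rw [h]), Finset.mem_univ j⟩, rfl⟩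
      · exact Or.inr ⟨hz, hr⟩
    · rintro (⟨j, hj, rfl⟩ | ⟨hz, hr⟩)
      · exact ⟨hRR j, fun h => (Finset.mem_erase.1 hj).1 (hR h)⟩
      · exact ⟨hz, fun h => hr ⟨i, h.symm⟩⟩
  have hdisjR : ∀ i, Disjoint (↑((Finset.univ.erase i).image R) : Set E3) (Rcf.points \ Set.range R) := by
    intro i
    rw [Set.disjoint_left]
    rintro z hz ⟨-, hr⟩
    rw [Finset.mem_coe, Finset.mem_image] at hz
    obtain ⟨j, -, rfl⟩ := hz
    exact hr ⟨j, rfl⟩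
  have hE7 : ∀ i, siteR (R i) = ∑ j ∈ Finset.univ.erase i, lennardJones (dist (R i) (R j)) + H i := by
    intro i
    simp only [hsiteR, hH]
    have hsub : {z : E3 | z ∈ Rcf.points ∧ z ≠ R i} ⊆ {y : E3 | y ∈ Ap.points ∧ y ≠ R i} := fun z hz =>
      ⟨by rw [hunion]; exact Or.inr hz.1, hz.2⟩
    have hS1 : Summable ((fun z : E3 => lennardJones (dist (R i) z)) ∘ (↑) : (↑((Finset.univ.erase i).image R) : Set E3) → ℝ) :=
      summable_lennardJones_subset Ap (R i) (fun z hz => hsub (by rw [hsetR i]; exact Or.inl hz))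
    have hS2 : Summable ((fun z : E3 => lennardJones (dist (R i) z)) ∘ (↑) : (Rcf.points \ Set.range R : Set E3) → ℝ) :=
      summable_lennardJones_subset Ap (R i) (fun z hz => hsub (by rw [hsetR i]; exact Or.inr hz))
    have h := hS1.tsum_union_disjoint (hdisjR i) hS2
    rw [← tsum_congr_set_coe (fun z : E3 => lennardJones (dist (R i) z)) (hsetR i)] at h
    have hfin : ∑' x : (↑((Finset.univ.erase i).image R) : Set E3), lennardJones (dist (R i) x) =
        ∑ x ∈ (Finset.univ.erase i).image R, lennardJones (dist (R i) x) :=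
      Finset.tsum_subtype' _ (fun z => lennardJones (dist (R i) z))
    rw [hfin, Finset.sum_image (fun j _ l _ hjl => hR hjl)] at h
    exact h
  have hHle : ∀ i, H i ≤ 0 := fun i => by
    simp only [hH]
    exact tsum_nonpos fun z => lennardJones_nonpos (hfarR z.1 z.2.1 z.2.2 i)
  have hE8 : 2 * interactionEnergy lennardJones R = ∑ i, ∑ j ∈ Finset.univ.erase i, lennardJones (dist (R i) (R j)) :=
    two_mul_interactionEnergy lennardJones R
  have hsum6 : ∑ i, siteAp (R i) = ∑ i, IR i + ∑ i, siteR (R i) := by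
    rw [← Finset.sum_add_distrib]; exact Finset.sum_congr rfl fun i _ => hE6 i
  have hsum7 : ∑ i, siteR (R i) = ∑ i, ∑ j ∈ Finset.univ.erase i, lennardJones (dist (R i) (R j)) + ∑ i, H i := by
    rw [← Finset.sum_add_distrib]; exact Finset.sum_congr rfl fun i _ => hE7 i
  have hHsum : ∑ i, H i ≤ 0 := Finset.sum_nonpos fun i _ => hHle i
  have hv : interactionEnergy lennardJones R + ∑ i, IR i < e * k := hviol
  have hc : 2 * ((P.motif.card : ℝ) + k) * e = 2 * (P.motif.card : ℝ) * e + 2 * (k : ℝ) * e := by ring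
  linarith only [hE1, hE2, hE2', hE3, hE45, hsum6, hsum7, hHsum, hE8, hv, hc]

/-- Every Lennard-Jones field over a `δ`-separated point set of `ℝ³` is summable (at ANY base point). [folklore] -/
theorem summable_field (Q : PeriodicConfiguration 3) {δ : ℝ} (hδ : 0 < δ)
    (hsep : ∀ p ∈ Q.points, ∀ q ∈ Q.points, p ≠ q → δ ≤ dist p q) (r : E3) :
    Summable fun y : ↥Q.points => lennardJones (dist r y) :=
  UniformlyDiscrete.summable_lennardJones_dist (X := Q.points) ⟨δ, hδ, hsep⟩ r

/-- **AN EXACT PERIODIC MINIMISER IS AN `e⋆`-μGSC (periodic case of the μ-equilibrium door, unconditional).**  If a `δ`-separated periodic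
configuration `Q` of `ℝ³` has `e(Q) ≤ e⋆`, then `Q.points` is an `e⋆`-μ-ground-state configuration of `V_LJ` in the sense of Sütő: no
finite surgery «remove `n` atoms, insert `k` atoms» lowers `U − e⋆·#`. [folklore] -/
theorem isMuGSC_points_of_energyPerParticle_le (Q : PeriodicConfiguration 3)
    {δ : ℝ} (hδ : 0 < δ) (hsep : ∀ p ∈ Q.points, ∀ q ∈ Q.points, p ≠ q → δ ≤ dist p q)
    (hopt : Q.energyPerParticle lennardJones ≤ ⨅ Q' : PeriodicConfiguration 3, Q'.energyPerParticle lennardJones) :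
    IsMuGSC lennardJones (⨅ Q' : PeriodicConfiguration 3, Q'.energyPerParticle lennardJones) Q.points := by
  classical
  have heq : Q.energyPerParticle lennardJones = ⨅ Q' : PeriodicConfiguration 3, Q'.energyPerParticle lennardJones :=
    le_antisymm hopt (eStar_le Q)
  refine ⟨summable_field Q hδ hsep, fun n xf hxf hX k R hR hdisj => ?_⟩
  by_contra hlt
  rw [not_le] at hlt
  rw [← heq] at hlt
  rcases Nat.eq_zero_or_pos n with hn0 | hnpos
  · subst hn0
    rcases Nat.eq_zero_or_pos k with hk0 | hkpos
    · subst hk0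
      have h2 : interactionEnergy lennardJones xf = 0 := interactionEnergy_of_subsingleton _ _
      have h2' : interactionEnergy lennardJones R = 0 := interactionEnergy_of_subsingleton _ _
      have h3 : (∑ i : Fin 0, ∑' y : ↥(Q.points \ Set.range xf), lennardJones (dist (xf i) y)) = 0 := Finset.sum_of_isEmpty _
      have h3' : (∑ i : Fin 0, ∑' y : ↥(Q.points \ Set.range xf), lennardJones (dist (R i) y)) = 0 := Finset.sum_of_isEmpty _
      rw [h2, h2', h3, h3'] at hlt
      simp at hlt
    · -- pure insertion
      have hempty : Q.points \ Set.range xf = Q.points := by rw [Set.range_eq_empty, Set.sdiff_empty]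
      have hRQ : ∀ i, R i ∉ Q.points := fun i h =>
        Set.disjoint_left.1 hdisj ⟨i, rfl⟩ (by rw [hempty]; exact h)
      have h := eStar_lt_energyPerParticle_of_insertion_periodic Q hδ hsep hkpos hR hRQ ?_
      · rw [heq] at h; exact lt_irrefl _ h
      have h2 : interactionEnergy lennardJones xf = 0 := interactionEnergy_of_subsingleton _ _
      have h3 : (∑ i : Fin 0, ∑' y : ↥(Q.points \ Set.range xf), lennardJones (dist (xf i) y)) = 0 := Finset.sum_of_isEmpty _
      have hre : ∀ i, (∑' y : ↥(Q.points \ Set.range xf), lennardJones (dist (R i) y)) = ∑' y : ↥Q.points, lennardJones (dist (R i) y) :=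
        fun i => tsum_congr_set_coe (fun y : E3 => lennardJones (dist (R i) y)) hempty
      have h4 : (∑ i, ∑' y : ↥(Q.points \ Set.range xf), lennardJones (dist (R i) y)) = ∑ i, ∑' y : ↥Q.points, lennardJones (dist (R i) y) :=
        Finset.sum_congr rfl fun i _ => hre i
      have h5 : Q.energyPerParticle lennardJones * ((0 : ℕ) : ℝ) = 0 := by simp
      rw [h5] at hlt
      linarith
  · have h := eStar_lt_energyPerParticle_of_surgery_periodic Q hδ hsep hnpos hxf hX hR hdisj (by linarith)
    rw [heq] at h; exact lt_irrefl _ h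

end Summit.AtomisticToContinuum.Crystallization.Theorems.FrustratedLawDichotomyPeriodicMuGSC

end
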